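import Summits.KontsevichZagierPeriods.KontsevichZagierPeriods.Theorems.ValuedFieldSpecialisationParametricLiftingStrata
import Summits.KontsevichZagierPeriods.KontsevichZagierPeriods.Theorems.ValuedFieldSpecialisationParametricLiftingGradedLevelEmptyNet
import Summits.KontsevichZagierPeriods.KontsevichZagierPeriods.Theorems.ValuedFieldSpecialisationParametricLiftingGradedLevelStep
import Summits.KontsevichZagierPeriods.KontsevichZagierPeriods.Theorems.ValuedFieldSpecialisationParametricLiftingGradedSpecialFibreOfKernelLevel
import Summits.KontsevichZagierPeriods.KontsevichZagierPeriods.Theorems.ValuedFieldSpecialisationParametricLiftingGradedSpecialFibreOne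
import Summits.KontsevichZagierPeriods.KontsevichZagierPeriods.Theorems.ValuedFieldSpecialisationParametricLiftingGradedSpecialFibreTwoOfPlanarAreas
import Summits.KontsevichZagierPeriods.KontsevichZagierPeriods.Theorems.ValuedFieldSpecialisationParametricLiftingGradedSpecialFibreTwoRational

/-!
# Route ValuedFieldSpecialisation — crux `ParametricLifting` (stmt-KontsevichZagierPeriods-3498):
# THE LEVEL-WISE LOSSLESS SPLIT (lead c9)

Helper (`--supports stmt-KontsevichZagierPeriods-3498`) for line `registered`. Leads c7/c8 reduced the crux to
the dimension ladder: level `E` := `AddSubgroup.closure {[r] | dim r < E}`, KL(`E`) := the kernel conjecture on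
level `E`; the crux follows from RLG (graded regularised lifting) and SF (special-fibre rigidity: special fibres of
DOMINATED families whose combination is a FIBRED relation form a relation), SF being supplied by the sibling crux
`CTConstruction` (stmt-3495). That bootstrap spends SF at EVERY fibre dimension, also on the levels `≤ 2` that the
shared item `PlanarAreas` (stmt-4990) already settles, and RLG lets the certifying dominated net live in any
dimension. This file grades both sides and shows the split is lossless LEVEL BY LEVEL:

* SFG(`E`) := SF for families whose fibres have dimension `< E` (wave-1 files `…GradedSpecialFibre*.lean`:
  KL(`E`) ⇒ SFG(`E`), p172334; SFG(`1`) unconditional, p172357; `PlanarAreas` ⇒ SFG(`2`), p172358; SFG(`2`) for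
  rational special fibres unconditional, p172365);
* RLG′(`E`) := RLG(`E`) whose dominated net has fibres of dimension `< E` (KL(`E`) ⇒ RLG′(`E`), p172255; the step
  KL(`E`) → RLG′(`E+1`) → SFG(`E+1`) → KL(`E+1`), p172325).

Results (no definitions; everything inlined in the types):
* `stub_kernelLevel_succ_iff_graded` — **over KL(`E`): KL(`E+1`) ⇔ RLG′(`E+1`) ∧ SFG(`E+1`)**: at every level the
  pair (regularised lifting, special-fibre rigidity) is EXACTLY that level's kernel conjecture (⇔ the volume
  conjecture for compact bodies of `ℝ^{E+1}`, `kernelLevel_succ_iff_volumeConjecture`, p168377);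
* `kernelLevel_le_two_of_planarAreas`, `specialFibreGraded_le_two_of_planarAreas`, `regLiftGradedLevel_le_two_of_planarAreas`
  — levels `≤ 2` of BOTH sides are item 4990 alone (no `CTConstruction` below fibre dimension 2);
* `kernelLevel_all_of_planarAreas_of_graded_ge_three` and `parametricLifting_of_planarAreas_of_graded_ge_three` — the
  composition of the reshaped skeleton (stubs: `PlanarAreas` verbatim, RLG′ on levels `≥ 3`, SFG on levels `≥ 3`);
* `stub_kontsevichZagierPeriods_iff_planarAreas_and_graded_ge_three` — **summit ⇔ PlanarAreas ∧ RLG′(≥3) ∧ SFG(≥3)**: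
  the reshaped stub set is lossless and each stub is summit-implied;
* `specialFibre_iff_forall_specialFibreGraded` — SF ⇔ ∀ E, SFG(`E`); `specialFibreGraded_succ_of_volumeConjecture`,
  `regLiftGradedLevel_succ_of_volumeConjecture` — level `D+1` of either side from the volume conjecture in `ℝ^{D+1}`.

Sources: M. Kontsevich, D. Zagier, *Periods* (2001), §1.2, Conjecture 1; J. Cresson, J. Viu-Sos, *On the equality
of periods of Kontsevich–Zagier*, JTNB 34 (2022), §1 (volume form, graded by dimension); A. Huber, G. Wüstholz,
*Transcendence and linear relations of 1-periods* (2022), Thm. 13.3 (the printed input behind level 2 =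
`PlanarAreas`). The fibred / dominated / elementary vocabulary is this route's. No definitions.
-/

noncomputable section

namespace Summit.KontsevichZagierPeriods.ValuedFieldSpecialisation

open MeasureTheory Set Filter
open scoped Topology
open Literature.NumberTheory.Transcendental
open Summit.KontsevichZagierPeriods.KontsevichZagierPeriods.Theses.ValuedFieldSpecialisation (ParametricLifting CTConstruction)
open Summit.KontsevichZagierPeriods.KontsevichZagierPeriods.Theses.LowDimension (PlanarAreas)

/-! ### The level-wise lossless split -/

/-- **Over KL(`E`): KL(`E+1`) ⇔ RLG′(`E+1`) ∧ SFG(`E+1`).** Given the kernel conjecture on level `E`, the kernel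
conjecture on level `E + 1` is EQUIVALENT to the conjunction of the fibre-graded regularised lifting on level
`E + 1` and the graded special-fibre rigidity for fibres of dimension `≤ E`: (⇒) empty net
(`stub_regLiftGradedLevel_of_kernelLevel`) and value shadow (`stub_specialFibreGraded_of_kernelLevel`);
(⇐) the graded induction step (`stub_kernelLevel_succ_of_graded`). [cite: KontsevichZagier2001, §1.2 Conjecture 1] -/
theorem stub_kernelLevel_succ_iff_graded : ∀ (E : ℕ), (∀ (x : KZ.FormalRep), x ∈ AddSubgroup.closure {y : KZ.FormalRep | ∃ (n : ℕ) (r : KZ.IntegralRep n), n < E ∧ y = KZ.of r} → KZ.eval x = 0 → x ∈ KZ.relations) → ((∀ (x : KZ.FormalRep), x ∈ AddSubgroup.closure {y : KZ.FormalRep | ∃ (n : ℕ) (r : KZ.IntegralRep n), n < E + 1 ∧ y = KZ.of r} → KZ.eval x = 0 → x ∈ KZ.relations) ↔ (∀ (x : KZ.FormalRep), x ∈ AddSubgroup.closure {y : KZ.FormalRep | ∃ (n : ℕ) (r : KZ.IntegralRep n), n < E + 1 ∧ y = KZ.of r} → KZ.eval x = 0 → ∃ H ∈ KZ.fibredRelations,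 ∃ (k : ℕ) (m : Fin k → ℤ) (p q b d : Fin k → ℕ) (ρ : (i : Fin k) → KZ.IntegralRep (d i)) (P : (i : Fin k) → KZ.IntegralRep (b i + d i + 1 + 1)) (k₂ : ℕ) (d₂ : Fin k₂ → ℕ) (m₂ : Fin k₂ → ℤ) (R : (j : Fin k₂) → KZ.IntegralRep (d₂ j + 1)) (r₀ g : (j : Fin k₂) → KZ.IntegralRep (d₂ j)), (∀ i, 0 < q i ∧ p i < q i ∧ (0 < p i ∨ 0 < b i) ∧ d i + 1 < E + 1 ∧ (P i).domain = {z | ∃ (s u : ℝ) (y : Fin (b i) → ℝ) (w : Fin (d i) → ℝ), z = Matrix.vecCons s (Matrix.vecCons u (Fin.append y w)) ∧ 0 < s ∧ s < 1 ∧ 0 < u ∧ u ^ (q i) * s ^ (p i) < 1 ∧ (∀ j, s ≤ y j ∧ y j ≤ 1) ∧ w ∈ (ρ i).domain} ∧ (P i).integrand = fun z => (∏ j : Fin (b i), (z (Fin.castAdd (d i) j).succ.succ)⁻¹) * (ρ i).integrand (fun l : Fin (d i) => z (Fin.natAdd (b i) l).succ.succ)) ∧ (∀ j, d₂ j < E +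 1 ∧ KZ.IsDominatedFamily (R j) (r₀ j) (g j)) ∧ H = (∑ i, m i • KZ.of (P i)) + (∑ j, m₂ j • KZ.of (R j)) ∧ (∑ j, m₂ j • KZ.of (r₀ j)) - x ∈ KZ.relations) ∧ (∀ (k : ℕ) (d : Fin k → ℕ) (m : Fin k → ℤ) (R : (i : Fin k) → KZ.IntegralRep (d i + 1)) (r₀ g : (i : Fin k) → KZ.IntegralRep (d i)), (∀ i, d i < E + 1) → (∀ i, KZ.IsDominatedFamily (R i) (r₀ i) (g i)) → (∑ i, m i • KZ.of (R i)) ∈ KZ.fibredRelations → (∑ i, m i • KZ.of (r₀ i)) ∈ KZ.relations)) := by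
  intro E hK
  exact ⟨fun h => ⟨stub_regLiftGradedLevel_of_kernelLevel (E + 1) h, stub_specialFibreGraded_of_kernelLevel (E + 1) h⟩,
    fun h => stub_kernelLevel_succ_of_graded E hK h.1 h.2⟩

/-! ### Levels `≤ 2` of both sides are `PlanarAreas` (stmt-KontsevichZagierPeriods-4990) alone -/

/-- **`PlanarAreas` ⇒ KL(`E`) for every `E ≤ 2`**: level `E ≤ 2` is contained in level `2`
(`AddSubgroup.closure_mono`), and KL(`2`) ⇔ `PlanarAreas` (`kernelLevelTwo_iff_planarAreas`, p168377).
[cite: HuberWustholz2022, Thm. 13.3] -/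
theorem kernelLevel_le_two_of_planarAreas (h : PlanarAreas) :
    ∀ (E : ℕ), E ≤ 2 → (∀ (x : KZ.FormalRep), x ∈ AddSubgroup.closure {y : KZ.FormalRep | ∃ (n : ℕ) (r : KZ.IntegralRep n), n < E ∧ y = KZ.of r} → KZ.eval x = 0 → x ∈ KZ.relations) := by
  intro E hE x hx hx0
  refine kernelLevelTwo_iff_planarAreas.mpr h x (AddSubgroup.closure_mono ?_ hx) hx0
  rintro _ ⟨n, r, hn, rfl⟩
  exact ⟨n, r, by omega, rfl⟩

/-- **`PlanarAreas` ⇒ SFG(`E`) for every `E ≤ 2`** (special-fibre rigidity below fibre dimension `2` needs no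
`CTConstruction`): from `stub_specialFibreGraded_two_of_planarAreas` (p172358), fibres of dimension `< E ≤ 2`.
[cite: HuberWustholz2022, Thm. 13.3] -/
theorem specialFibreGraded_le_two_of_planarAreas (h : PlanarAreas) :
    ∀ (E : ℕ), E ≤ 2 → (∀ (k : ℕ) (d : Fin k → ℕ) (m : Fin k → ℤ) (R : (i : Fin k) → KZ.IntegralRep (d i + 1)) (r₀ g : (i : Fin k) → KZ.IntegralRep (d i)), (∀ i, d i < E) → (∀ i, KZ.IsDominatedFamily (R i) (r₀ i) (g i)) → (∑ i, m i • KZ.of (R i)) ∈ KZ.fibredRelations → (∑ i, m i • KZ.of (r₀ i)) ∈ KZ.relations) :=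
  fun _ hE k d m R r₀ g hd hR hG =>
    stub_specialFibreGraded_two_of_planarAreas h k d m R r₀ g (fun i => by have := hd i; omega) hR hG

/-- **`PlanarAreas` ⇒ RLG′(`E`) for every `E ≤ 2`** (empty net over `kernelLevel_le_two_of_planarAreas`).
[cite: HuberWustholz2022, Thm. 13.3] -/
theorem regLiftGradedLevel_le_two_of_planarAreas (h : PlanarAreas) :
    ∀ (E : ℕ), E ≤ 2 → (∀ (x : KZ.FormalRep), x ∈ AddSubgroup.closure {y : KZ.FormalRep | ∃ (n : ℕ) (r : KZ.IntegralRep n), n < E ∧ y = KZ.of r} → KZ.eval x = 0 → ∃ H ∈ KZ.fibredRelations, ∃ (k : ℕ) (m : Fin k → ℤ) (p q b d : Fin k → ℕ) (ρ : (i : Fin k) → KZ.IntegralRep (d i)) (P : (i : Fin k) → KZ.IntegralRep (b i + d i + 1 + 1)) (k₂ : ℕ) (d₂ : Fin k₂ → ℕ) (m₂ : Fin k₂ → ℤ) (R : (j : Fin k₂) → KZ.IntegralRep (d₂ j + 1)) (r₀ g : (j : Fin k₂) → KZ.IntegralRep (d₂ j)), (∀ i, 0 < q i ∧ p i < q i ∧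 (0 < p i ∨ 0 < b i) ∧ d i + 1 < E ∧ (P i).domain = {z | ∃ (s u : ℝ) (y : Fin (b i) → ℝ) (w : Fin (d i) → ℝ), z = Matrix.vecCons s (Matrix.vecCons u (Fin.append y w)) ∧ 0 < s ∧ s < 1 ∧ 0 < u ∧ u ^ (q i) * s ^ (p i) < 1 ∧ (∀ j, s ≤ y j ∧ y j ≤ 1) ∧ w ∈ (ρ i).domain} ∧ (P i).integrand = fun z => (∏ j : Fin (b i), (z (Fin.castAdd (d i) j).succ.succ)⁻¹) * (ρ i).integrand (fun l : Fin (d i) => z (Fin.natAdd (b i) l).succ.succ)) ∧ (∀ j, d₂ j < E ∧ KZ.IsDominatedFamily (R j) (r₀ j) (g j)) ∧ H = (∑ i, m i • KZ.of (P i)) + (∑ j, m₂ j • KZ.of (R j)) ∧ (∑ j, m₂ j • KZ.of (r₀ j)) - x ∈ KZ.relations) :=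
  fun E hE => stub_regLiftGradedLevel_of_kernelLevel E (kernelLevel_le_two_of_planarAreas h E hE)

/-! ### The composition of the reshaped skeleton -/

/-- **KL at every level from `PlanarAreas`, RLG′(≥3) and SFG(≥3)**: levels `≤ 2` by
`kernelLevel_le_two_of_planarAreas`; the step `E → E + 1` for `E ≥ 2` by `stub_kernelLevel_succ_of_graded` fed with
RLG′(`E+1`) and SFG(`E+1`), `E + 1 ≥ 3`. [cite: KontsevichZagier2001, §1.2 Conjecture 1] -/
theorem kernelLevel_all_of_planarAreas_of_graded_ge_three (h2 : PlanarAreas)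
    (hR : ∀ (E : ℕ), 3 ≤ E → (∀ (x : KZ.FormalRep), x ∈ AddSubgroup.closure {y : KZ.FormalRep | ∃ (n : ℕ) (r : KZ.IntegralRep n), n < E ∧ y = KZ.of r} → KZ.eval x = 0 → ∃ H ∈ KZ.fibredRelations, ∃ (k : ℕ) (m : Fin k → ℤ) (p q b d : Fin k → ℕ) (ρ : (i : Fin k) → KZ.IntegralRep (d i)) (P : (i : Fin k) → KZ.IntegralRep (b i + d i + 1 + 1)) (k₂ : ℕ) (d₂ : Fin k₂ → ℕ) (m₂ : Fin k₂ → ℤ) (R : (j : Fin k₂) → KZ.IntegralRep (d₂ j + 1)) (r₀ g : (j : Fin k₂) → KZ.IntegralRep (d₂ j)), (∀ i, 0 < q i ∧ p i < q i ∧ (0 < p i ∨ 0 < b i) ∧ d i + 1 < E ∧ (P i).domain = {z | ∃ (s u : ℝ) (y : Fin (b i) → ℝ) (w : Fin (d i) → ℝ), z = Matrix.vecCons s (Matrix.vecCons u (Fin.append y w)) ∧ 0 < s ∧ s < 1 ∧ 0 < u ∧ u ^ (q i) * s ^ (p i) < 1 ∧ (∀ j, s ≤ y j ∧ y j ≤ 1)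 ∧ w ∈ (ρ i).domain} ∧ (P i).integrand = fun z => (∏ j : Fin (b i), (z (Fin.castAdd (d i) j).succ.succ)⁻¹) * (ρ i).integrand (fun l : Fin (d i) => z (Fin.natAdd (b i) l).succ.succ)) ∧ (∀ j, d₂ j < E ∧ KZ.IsDominatedFamily (R j) (r₀ j) (g j)) ∧ H = (∑ i, m i • KZ.of (P i)) + (∑ j, m₂ j • KZ.of (R j)) ∧ (∑ j, m₂ j • KZ.of (r₀ j)) - x ∈ KZ.relations))
    (hS : ∀ (E : ℕ), 3 ≤ E → (∀ (k : ℕ) (d : Fin k → ℕ) (m : Fin k → ℤ) (R : (i : Fin k) → KZ.IntegralRep (d i + 1)) (r₀ g : (i : Fin k) → KZ.IntegralRep (d i)), (∀ i, d i < E) → (∀ i, KZ.IsDominatedFamily (R i) (r₀ i) (g i)) → (∑ i, m i • KZ.of (R i)) ∈ KZ.fibredRelations → (∑ i, m i • KZ.of (r₀ i)) ∈ KZ.relations)) :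
    ∀ (E : ℕ), (∀ (x : KZ.FormalRep), x ∈ AddSubgroup.closure {y : KZ.FormalRep | ∃ (n : ℕ) (r : KZ.IntegralRep n), n < E ∧ y = KZ.of r} → KZ.eval x = 0 → x ∈ KZ.relations) := by
  intro E
  induction E with
  | zero => exact kernelLevel_le_two_of_planarAreas h2 0 (by omega)
  | succ E ih =>
    rcases Nat.lt_or_ge (E + 1) 3 with hE | hE
    · exact kernelLevel_le_two_of_planarAreas h2 (E + 1) (by omega)
    · exact stub_kernelLevel_succ_of_graded E ih (hR (E + 1) hE) (hS (E + 1) hE)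

/-- **`KZKernelConjecture` from `PlanarAreas`, RLG′(≥3) and SFG(≥3)** (every formal combination lies on some
level, `stub_exists_dimBound`, p164935). [cite: KontsevichZagier2001, §1.2 Conjecture 1] -/
theorem kzKernelConjecture_of_planarAreas_of_graded_ge_three (h2 : PlanarAreas)
    (hR : ∀ (E : ℕ), 3 ≤ E → (∀ (x : KZ.FormalRep), x ∈ AddSubgroup.closure {y : KZ.FormalRep | ∃ (n : ℕ) (r : KZ.IntegralRep n), n < E ∧ y = KZ.of r} → KZ.eval x = 0 → ∃ H ∈ KZ.fibredRelations, ∃ (k : ℕ) (m : Fin k → ℤ) (p q b d : Fin k → ℕ) (ρ : (i : Fin k) → KZ.IntegralRep (d i)) (P : (i : Fin k) → KZ.IntegralRep (b i + d i + 1 + 1)) (k₂ : ℕ) (d₂ : Fin k₂ → ℕ) (m₂ : Fin k₂ → ℤ) (R : (j : Fin k₂) → KZ.IntegralRep (d₂ j + 1)) (r₀ g : (j : Fin k₂) → KZ.IntegralRep (d₂ j)), (∀ i, 0 < q i ∧ p i < q i ∧ (0 < p i ∨ 0 < b i) ∧ d i + 1 < E ∧ (P i).domain = {z | ∃ (s u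 : ℝ) (y : Fin (b i) → ℝ) (w : Fin (d i) → ℝ), z = Matrix.vecCons s (Matrix.vecCons u (Fin.append y w)) ∧ 0 < s ∧ s < 1 ∧ 0 < u ∧ u ^ (q i) * s ^ (p i) < 1 ∧ (∀ j, s ≤ y j ∧ y j ≤ 1) ∧ w ∈ (ρ i).domain} ∧ (P i).integrand = fun z => (∏ j : Fin (b i), (z (Fin.castAdd (d i) j).succ.succ)⁻¹) * (ρ i).integrand (fun l : Fin (d i) => z (Fin.natAdd (b i) l).succ.succ)) ∧ (∀ j, d₂ j < E ∧ KZ.IsDominatedFamily (R j) (r₀ j) (g j)) ∧ H = (∑ i, m i • KZ.of (P i)) + (∑ j, m₂ j • KZ.of (R j)) ∧ (∑ j, m₂ j • KZ.of (r₀ j)) - x ∈ KZ.relations))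
    (hS : ∀ (E : ℕ), 3 ≤ E → (∀ (k : ℕ) (d : Fin k → ℕ) (m : Fin k → ℤ) (R : (i : Fin k) → KZ.IntegralRep (d i + 1)) (r₀ g : (i : Fin k) → KZ.IntegralRep (d i)), (∀ i, d i < E) → (∀ i, KZ.IsDominatedFamily (R i) (r₀ i) (g i)) → (∑ i, m i • KZ.of (R i)) ∈ KZ.fibredRelations → (∑ i, m i • KZ.of (r₀ i)) ∈ KZ.relations)) :
    KZKernelConjecture := by
  intro x hx
  obtain ⟨E, hE⟩ := stub_exists_dimBound x
  exact kernelLevel_all_of_planarAreas_of_graded_ge_three h2 hR hS E x hE hx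

/-- **The summit from `PlanarAreas`, RLG′(≥3) and SFG(≥3)** (`kzKernelConjecture_iff_isRational`).
[cite: KontsevichZagier2001, §1.2 Conjecture 1] -/
theorem kontsevichZagierPeriods_of_planarAreas_of_graded_ge_three (h2 : PlanarAreas)
    (hR : ∀ (E : ℕ), 3 ≤ E → (∀ (x : KZ.FormalRep), x ∈ AddSubgroup.closure {y : KZ.FormalRep | ∃ (n : ℕ) (r : KZ.IntegralRep n), n < E ∧ y = KZ.of r} → KZ.eval x = 0 → ∃ H ∈ KZ.fibredRelations, ∃ (k : ℕ) (m : Fin k → ℤ) (p q b d : Fin k → ℕ) (ρ : (i : Fin k) → KZ.IntegralRep (d i)) (P : (i : Fin k) → KZ.IntegralRep (b i + d i + 1 + 1)) (k₂ : ℕ) (d₂ : Fin k₂ → ℕ) (m₂ : Fin k₂ → ℤ) (R : (j : Fin k₂) → KZ.IntegralRep (d₂ j + 1)) (r₀ g : (j : Fin k₂) → KZ.IntegralRep (d₂ j)), (∀ i, 0 < q i ∧ p i < q i ∧ (0 < p i ∨ 0 < b i) ∧ d i + 1 < E ∧ (P i).domain = {z | ∃ (s u : ℝ) (y : Fin (b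 i) → ℝ) (w : Fin (d i) → ℝ), z = Matrix.vecCons s (Matrix.vecCons u (Fin.append y w)) ∧ 0 < s ∧ s < 1 ∧ 0 < u ∧ u ^ (q i) * s ^ (p i) < 1 ∧ (∀ j, s ≤ y j ∧ y j ≤ 1) ∧ w ∈ (ρ i).domain} ∧ (P i).integrand = fun z => (∏ j : Fin (b i), (z (Fin.castAdd (d i) j).succ.succ)⁻¹) * (ρ i).integrand (fun l : Fin (d i) => z (Fin.natAdd (b i) l).succ.succ)) ∧ (∀ j, d₂ j < E ∧ KZ.IsDominatedFamily (R j) (r₀ j) (g j)) ∧ H = (∑ i, m i • KZ.of (P i)) + (∑ j, m₂ j • KZ.of (R j)) ∧ (∑ j, m₂ j • KZ.of (r₀ j)) - x ∈ KZ.relations))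
    (hS : ∀ (E : ℕ), 3 ≤ E → (∀ (k : ℕ) (d : Fin k → ℕ) (m : Fin k → ℤ) (R : (i : Fin k) → KZ.IntegralRep (d i + 1)) (r₀ g : (i : Fin k) → KZ.IntegralRep (d i)), (∀ i, d i < E) → (∀ i, KZ.IsDominatedFamily (R i) (r₀ i) (g i)) → (∑ i, m i • KZ.of (R i)) ∈ KZ.fibredRelations → (∑ i, m i • KZ.of (r₀ i)) ∈ KZ.relations)) :
    KontsevichZagierPeriods :=
  kzKernelConjecture_iff_isRational.mp (kzKernelConjecture_of_planarAreas_of_graded_ge_three h2 hR hS)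

/-- **The crux `ParametricLifting` from `PlanarAreas`, RLG′(≥3) and SFG(≥3)** — the composition of the reshaped
skeleton of line `registered` (lead c9), through the summit with `G := 0` (`parametricLifting_of_kzKernelConjecture`).
[cite: KontsevichZagier2001, §1.2 Conjecture 1] -/
theorem parametricLifting_of_planarAreas_of_graded_ge_three (h2 : PlanarAreas)
    (hR : ∀ (E : ℕ), 3 ≤ E → (∀ (x : KZ.FormalRep), x ∈ AddSubgroup.closure {y : KZ.FormalRep | ∃ (n : ℕ) (r : KZ.IntegralRep n), n < E ∧ y = KZ.of r} → KZ.eval x = 0 → ∃ H ∈ KZ.fibredRelations, ∃ (k : ℕ) (m : Fin k → ℤ) (p q b d : Fin k → ℕ) (ρ : (i : Fin k) → KZ.IntegralRep (d i)) (P : (i : Fin k) → KZ.IntegralRep (b i + d i + 1 + 1)) (k₂ : ℕ) (d₂ : Fin k₂ → ℕ) (m₂ : Fin k₂ → ℤ) (R : (j : Fin k₂) → KZ.IntegralRep (d₂ j + 1)) (r₀ g : (j : Fin k₂) → KZ.IntegralRep (d₂ j)), (∀ i, 0 < q i ∧ p i < q i ∧ (0 < p i ∨ 0 < b i) ∧ d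 i + 1 < E ∧ (P i).domain = {z | ∃ (s u : ℝ) (y : Fin (b i) → ℝ) (w : Fin (d i) → ℝ), z = Matrix.vecCons s (Matrix.vecCons u (Fin.append y w)) ∧ 0 < s ∧ s < 1 ∧ 0 < u ∧ u ^ (q i) * s ^ (p i) < 1 ∧ (∀ j, s ≤ y j ∧ y j ≤ 1) ∧ w ∈ (ρ i).domain} ∧ (P i).integrand = fun z => (∏ j : Fin (b i), (z (Fin.castAdd (d i) j).succ.succ)⁻¹) * (ρ i).integrand (fun l : Fin (d i) => z (Fin.natAdd (b i) l).succ.succ)) ∧ (∀ j, d₂ j < E ∧ KZ.IsDominatedFamily (R j) (r₀ j) (g j)) ∧ H = (∑ i, m i • KZ.of (P i)) + (∑ j, m₂ j • KZ.of (R j)) ∧ (∑ j, m₂ j • KZ.of (r₀ j)) - x ∈ KZ.relations))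
    (hS : ∀ (E : ℕ), 3 ≤ E → (∀ (k : ℕ) (d : Fin k → ℕ) (m : Fin k → ℤ) (R : (i : Fin k) → KZ.IntegralRep (d i + 1)) (r₀ g : (i : Fin k) → KZ.IntegralRep (d i)), (∀ i, d i < E) → (∀ i, KZ.IsDominatedFamily (R i) (r₀ i) (g i)) → (∑ i, m i • KZ.of (R i)) ∈ KZ.fibredRelations → (∑ i, m i • KZ.of (r₀ i)) ∈ KZ.relations)) :
    ParametricLifting :=
  parametricLifting_of_kzKernelConjecture (kzKernelConjecture_of_planarAreas_of_graded_ge_three h2 hR hS)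

/-! ### Strength: each reshaped stub is summit-implied, and jointly they are the summit -/

/-- **`KZKernelConjecture` ⇒ KL(`E`)** on every level (restriction). [folklore] -/
theorem kernelLevel_of_kzKernelConjecture (hK : KZKernelConjecture) : ∀ (E : ℕ), (∀ (x : KZ.FormalRep), x ∈ AddSubgroup.closure {y : KZ.FormalRep | ∃ (n : ℕ) (r : KZ.IntegralRep n), n < E ∧ y = KZ.of r} → KZ.eval x = 0 → x ∈ KZ.relations) :=
  fun _ x _ hx0 => hK x hx0

/-- **Summit ⇔ `PlanarAreas` ∧ RLG′(≥3) ∧ SFG(≥3)** — the reshaped stub set of line `registered` is LOSSLESS: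
(⇐) `kontsevichZagierPeriods_of_planarAreas_of_graded_ge_three`; (⇒) the summit gives the kernel conjecture
(`kzKernelConjecture_iff_isRational`), hence KL on every level, hence `PlanarAreas` (`kernelLevelTwo_iff_planarAreas`),
RLG′ (empty net) and SFG (value shadow) on every level. [cite: KontsevichZagier2001, §1.2 Conjecture 1] -/
theorem stub_kontsevichZagierPeriods_iff_planarAreas_and_graded_ge_three : KontsevichZagierPeriods ↔ (∀ (r r' : KZ.IntegralRep 2), (∀ p ∈ r.domain, r.integrand p = 1) → (∀ p ∈ r'.domain, r'.integrand p = 1) → r.value = r'.value → KZ.Equivalent r r') ∧ (∀ (E : ℕ), 3 ≤ E → (∀ (x : KZ.FormalRep), x ∈ AddSubgroup.closure {y : KZ.FormalRep | ∃ (n : ℕ) (r : KZ.IntegralRep n), n < E ∧ y = KZ.of r} → KZ.eval x = 0 → ∃ H ∈ KZ.fibredRelations, ∃ (k : ℕ) (m : Fin k → ℤ) (p q b d : Fin k → ℕ) (ρ : (i : Fin k) → KZ.IntegralRep (d i)) (P : (i : Fin k) → KZ.IntegralRep (b i + d i + 1 + 1)) (k₂ : ℕ) (d₂ : Fin k₂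 → ℕ) (m₂ : Fin k₂ → ℤ) (R : (j : Fin k₂) → KZ.IntegralRep (d₂ j + 1)) (r₀ g : (j : Fin k₂) → KZ.IntegralRep (d₂ j)), (∀ i, 0 < q i ∧ p i < q i ∧ (0 < p i ∨ 0 < b i) ∧ d i + 1 < E ∧ (P i).domain = {z | ∃ (s u : ℝ) (y : Fin (b i) → ℝ) (w : Fin (d i) → ℝ), z = Matrix.vecCons s (Matrix.vecCons u (Fin.append y w)) ∧ 0 < s ∧ s < 1 ∧ 0 < u ∧ u ^ (q i) * s ^ (p i) < 1 ∧ (∀ j, s ≤ y j ∧ y j ≤ 1) ∧ w ∈ (ρ i).domain} ∧ (P i).integrand = fun z => (∏ j : Fin (b i), (z (Fin.castAdd (d i) j).succ.succ)⁻¹) * (ρ i).integrand (fun l : Fin (d i) => z (Fin.natAdd (b i) l).succ.succ)) ∧ (∀ j, d₂ j < E ∧ KZ.IsDominatedFamily (R j) (r₀ j) (g j)) ∧ H = (∑ i, m i • KZ.of (P i)) + (∑ j, m₂ j • KZ.of (R j)) ∧ (∑ j, m₂ j • KZ.of (r₀ j)) - x ∈ KZ.relations)) ∧ (∀ (E : ℕ),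 3 ≤ E → (∀ (k : ℕ) (d : Fin k → ℕ) (m : Fin k → ℤ) (R : (i : Fin k) → KZ.IntegralRep (d i + 1)) (r₀ g : (i : Fin k) → KZ.IntegralRep (d i)), (∀ i, d i < E) → (∀ i, KZ.IsDominatedFamily (R i) (r₀ i) (g i)) → (∑ i, m i • KZ.of (R i)) ∈ KZ.fibredRelations → (∑ i, m i • KZ.of (r₀ i)) ∈ KZ.relations)) := by
  refine ⟨fun h => ?_, fun h => kontsevichZagierPeriods_of_planarAreas_of_graded_ge_three h.1 h.2.1 h.2.2⟩
  have hK : ∀ (E : ℕ), (∀ (x : KZ.FormalRep), x ∈ AddSubgroup.closure {y : KZ.FormalRep | ∃ (n : ℕ) (r : KZ.IntegralRep n), n < E ∧ y = KZ.of r} → KZ.eval x = 0 → x ∈ KZ.relations) :=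
    kernelLevel_of_kzKernelConjecture (kzKernelConjecture_iff_isRational.mpr h)
  exact ⟨kernelLevelTwo_iff_planarAreas.mp (hK 2), fun E _ => stub_regLiftGradedLevel_of_kernelLevel E (hK E),
    fun E _ => stub_specialFibreGraded_of_kernelLevel E (hK E)⟩

/-! ### Graded vs. global special-fibre rigidity; rungs from the volume conjecture -/

/-- **SF ⇔ ∀ E, SFG(`E`)**: a finite family of fibres has bounded dimension (`E := 1 + Σ dᵢ` works).
[folklore] -/
theorem specialFibre_iff_forall_specialFibreGraded :
    (∀ (k : ℕ) (d : Fin k → ℕ) (m : Fin k → ℤ) (R : (i : Fin k) → KZ.IntegralRep (d i + 1)) (r₀ g : (i : Fin k) → KZ.IntegralRep (d i)), (∀ i, KZ.IsDominatedFamily (R i) (r₀ i) (g i)) → (∑ i, m i • KZ.of (R i)) ∈ KZ.fibredRelations → (∑ i, m i • KZ.of (r₀ i)) ∈ KZ.relations) ↔ ∀ (E : ℕ), (∀ (k : ℕ) (d : Fin k → ℕ) (m : Fin k → ℤ) (R : (i : Fin k) → KZ.IntegralRep (d i + 1)) (r₀ g : (i : Fin k) → KZ.IntegralRep (d i)), (∀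 i, d i < E) → (∀ i, KZ.IsDominatedFamily (R i) (r₀ i) (g i)) → (∑ i, m i • KZ.of (R i)) ∈ KZ.fibredRelations → (∑ i, m i • KZ.of (r₀ i)) ∈ KZ.relations) := by
  refine ⟨fun h _ k d m R r₀ g _ hR hG => h k d m R r₀ g hR hG, fun h k d m R r₀ g hR hG => ?_⟩
  refine h ((∑ i, d i) + 1) k d m R r₀ g (fun i => ?_) hR hG
  have : d i ≤ ∑ j, d j := Finset.single_le_sum (fun j _ => Nat.zero_le (d j)) (Finset.mem_univ i)
  omega

/-- **The volume conjecture in `ℝ^{D+1}` ⇒ SFG(`D+1`)** (special-fibre rigidity for fibres of dimension `≤ D`):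
`kernelLevel_succ_iff_volumeConjecture` (p168377) and `stub_specialFibreGraded_of_kernelLevel` (p172334).
[cite: CressonViusos2022, §1 p. 326 Conjecture] -/
theorem specialFibreGraded_succ_of_volumeConjecture (D : ℕ) (hV : (∀ (K₁ K₂ : KZ.IntegralRep (D + 1)), IsCompact K₁.domain → (interior K₁.domain).Nonempty → IsCompact K₂.domain → (interior K₂.domain).Nonempty → (∀ x ∈ K₁.domain, K₁.integrand x = 1) → (∀ x ∈ K₂.domain, K₂.integrand x = 1) → K₁.value = K₂.value → KZ.Equivalent K₁ K₂)) : (∀ (k : ℕ) (d : Fin k → ℕ) (m : Fin k → ℤ) (R : (i : Fin k) → KZ.IntegralRep (d i + 1)) (r₀ g : (i : Fin k) → KZ.IntegralRep (d i)), (∀ i, d i < D + 1) → (∀ i, KZ.IsDominatedFamily (R i) (r₀ i) (g i)) → (∑ i, m i • KZ.of (R i)) ∈ KZ.fibredRelations → (∑ i, m i • KZ.of (r₀ i)) ∈ KZ.relations) :=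
  stub_specialFibreGraded_of_kernelLevel (D + 1) ((kernelLevel_succ_iff_volumeConjecture D).mpr hV)

/-- **The volume conjecture in `ℝ^{D+1}` ⇒ RLG′(`D+1`)** (`kernelLevel_succ_iff_volumeConjecture`, empty net).
[cite: CressonViusos2022, §1 p. 326 Conjecture] -/
theorem regLiftGradedLevel_succ_of_volumeConjecture (D : ℕ) (hV : (∀ (K₁ K₂ : KZ.IntegralRep (D + 1)), IsCompact K₁.domain → (interior K₁.domain).Nonempty → IsCompact K₂.domain → (interior K₂.domain).Nonempty → (∀ x ∈ K₁.domain, K₁.integrand x = 1) → (∀ x ∈ K₂.domain, K₂.integrand x = 1) → K₁.value = K₂.value → KZ.Equivalent K₁ K₂)) : (∀ (x : KZ.FormalRep), x ∈ AddSubgroup.closure {y : KZ.FormalRep | ∃ (n : ℕ) (r : KZ.IntegralRep n), n < D + 1 ∧ y = KZ.of r} → KZ.eval x = 0 → ∃ H ∈ KZ.fibredRelations, ∃ (k : ℕ) (m : Fin k → ℤ) (p q b d : Fin k → ℕ) (ρ : (i : Fin k) → KZ.IntegralRep (d i)) (P : (i : Fin k) → KZ.IntegralRep (b i + d i + 1 +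 1)) (k₂ : ℕ) (d₂ : Fin k₂ → ℕ) (m₂ : Fin k₂ → ℤ) (R : (j : Fin k₂) → KZ.IntegralRep (d₂ j + 1)) (r₀ g : (j : Fin k₂) → KZ.IntegralRep (d₂ j)), (∀ i, 0 < q i ∧ p i < q i ∧ (0 < p i ∨ 0 < b i) ∧ d i + 1 < D + 1 ∧ (P i).domain = {z | ∃ (s u : ℝ) (y : Fin (b i) → ℝ) (w : Fin (d i) → ℝ), z = Matrix.vecCons s (Matrix.vecCons u (Fin.append y w)) ∧ 0 < s ∧ s < 1 ∧ 0 < u ∧ u ^ (q i) * s ^ (p i) < 1 ∧ (∀ j, s ≤ y j ∧ y j ≤ 1) ∧ w ∈ (ρ i).domain} ∧ (P i).integrand = fun z => (∏ j : Fin (b i), (z (Fin.castAdd (d i) j).succ.succ)⁻¹) * (ρ i).integrand (fun l : Fin (d i) => z (Fin.natAdd (b i) l).succ.succ)) ∧ (∀ j, d₂ j < D + 1 ∧ KZ.IsDominatedFamily (R j) (r₀ j) (g j)) ∧ H = (∑ i, m i • KZ.of (P i)) + (∑ j, m₂ j • KZ.of (R j)) ∧ (∑ j, m₂ j • KZ.of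 (r₀ j)) - x ∈ KZ.relations) :=
  stub_regLiftGradedLevel_of_kernelLevel (D + 1) ((kernelLevel_succ_iff_volumeConjecture D).mpr hV)

/-- **RLG′ ⇒ RLG** on every level (forget the fibre-dimension clause): the fibre-graded lifting of this file is a
STRENGTHENING of the c7/c8 graded regularised lifting, still summit-implied. [folklore] -/
theorem regLiftGraded_of_regLiftGradedLevel (E : ℕ) (h : (∀ (x : KZ.FormalRep), x ∈ AddSubgroup.closure {y : KZ.FormalRep | ∃ (n : ℕ) (r : KZ.IntegralRep n), n < E ∧ y = KZ.of r} → KZ.eval x = 0 → ∃ H ∈ KZ.fibredRelations, ∃ (k : ℕ) (m : Fin k → ℤ) (p q b d : Fin k → ℕ) (ρ : (i : Fin k) → KZ.IntegralRep (d i)) (P : (i : Fin k) → KZ.IntegralRep (b i + d i + 1 + 1)) (k₂ : ℕ) (d₂ : Fin k₂ → ℕ) (m₂ : Fin k₂ → ℤ) (R : (j : Fin k₂) → KZ.IntegralRep (d₂ j + 1)) (r₀ g : (j : Fin k₂) → KZ.IntegralRep (d₂ j)), (∀ i, 0 < q i ∧ p i < q i ∧ (0 < p i ∨ 0 < b i)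 ∧ d i + 1 < E ∧ (P i).domain = {z | ∃ (s u : ℝ) (y : Fin (b i) → ℝ) (w : Fin (d i) → ℝ), z = Matrix.vecCons s (Matrix.vecCons u (Fin.append y w)) ∧ 0 < s ∧ s < 1 ∧ 0 < u ∧ u ^ (q i) * s ^ (p i) < 1 ∧ (∀ j, s ≤ y j ∧ y j ≤ 1) ∧ w ∈ (ρ i).domain} ∧ (P i).integrand = fun z => (∏ j : Fin (b i), (z (Fin.castAdd (d i) j).succ.succ)⁻¹) * (ρ i).integrand (fun l : Fin (d i) => z (Fin.natAdd (b i) l).succ.succ)) ∧ (∀ j, d₂ j < E ∧ KZ.IsDominatedFamily (R j) (r₀ j) (g j)) ∧ H = (∑ i, m i • KZ.of (P i)) + (∑ j, m₂ j • KZ.of (R j)) ∧ (∑ j, m₂ j • KZ.of (r₀ j)) - x ∈ KZ.relations)) : (∀ (x : KZ.FormalRep), x ∈ AddSubgroup.closure {y : KZ.FormalRep | ∃ (n : ℕ) (r : KZ.IntegralRep n), n < E ∧ y = KZ.of r} → KZ.eval x = 0 → ∃ H ∈ KZ.fibredRelations, ∃ (k : ℕ) (m : Fin k → ℤ) (p q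 b d : Fin k → ℕ) (ρ : (i : Fin k) → KZ.IntegralRep (d i)) (P : (i : Fin k) → KZ.IntegralRep (b i + d i + 1 + 1)) (k₂ : ℕ) (d₂ : Fin k₂ → ℕ) (m₂ : Fin k₂ → ℤ) (R : (j : Fin k₂) → KZ.IntegralRep (d₂ j + 1)) (r₀ g : (j : Fin k₂) → KZ.IntegralRep (d₂ j)), (∀ i, 0 < q i ∧ p i < q i ∧ (0 < p i ∨ 0 < b i) ∧ d i + 1 < E ∧ (P i).domain = {z | ∃ (s u : ℝ) (y : Fin (b i) → ℝ) (w : Fin (d i) → ℝ), z = Matrix.vecCons s (Matrix.vecCons u (Fin.append y w)) ∧ 0 < s ∧ s < 1 ∧ 0 < u ∧ u ^ (q i) * s ^ (p i) < 1 ∧ (∀ j, s ≤ y j ∧ y j ≤ 1) ∧ w ∈ (ρ i).domain} ∧ (P i).integrand = fun z => (∏ j : Fin (b i), (z (Fin.castAdd (d i) j).succ.succ)⁻¹) * (ρ i).integrand (fun l : Fin (d i) => z (Fin.natAdd (b i) l).succ.succ)) ∧ (∀ j, KZ.IsDominatedFamily (R j) (r₀ j) (g j)) ∧ H = (∑ i,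 m i • KZ.of (P i)) + (∑ j, m₂ j • KZ.of (R j)) ∧ (∑ j, m₂ j • KZ.of (r₀ j)) - x ∈ KZ.relations) := by
  intro x hx hx0
  obtain ⟨H, hH, k, m, p, q, b, d, ρ, P, k₂, d₂, m₂, R, r₀, g, hP, hR, hHeq, hfib⟩ := h x hx hx0
  exact ⟨H, hH, k, m, p, q, b, d, ρ, P, k₂, d₂, m₂, R, r₀, g, hP, fun j => (hR j).2, hHeq, hfib⟩

/-! ### The suppliers of the two open halves -/

/-- **`CTConstruction` ⇒ SFG(`E`) on every level** (the sibling crux stmt-KontsevichZagierPeriods-3495 supplies the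
conservativity half in every dimension: `specialFibre_of_ctConstruction`, p152021, and
`specialFibre_iff_forall_specialFibreGraded`). [cite: KontsevichZagier2001, §1.2] -/
theorem specialFibreGraded_of_ctConstruction (hCT : CTConstruction) : ∀ (E : ℕ), (∀ (k : ℕ) (d : Fin k → ℕ) (m : Fin k → ℤ) (R : (i : Fin k) → KZ.IntegralRep (d i + 1)) (r₀ g : (i : Fin k) → KZ.IntegralRep (d i)), (∀ i, d i < E) → (∀ i, KZ.IsDominatedFamily (R i) (r₀ i) (g i)) → (∑ i, m i • KZ.of (R i)) ∈ KZ.fibredRelations → (∑ i, m i • KZ.of (r₀ i)) ∈ KZ.relations) :=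
  specialFibre_iff_forall_specialFibreGraded.mp (specialFibre_of_ctConstruction hCT)

/-- **`KZKernelConjecture` ⇒ RLG′(`E`) on every level** (empty net over `kernelLevel_of_kzKernelConjecture`): the
existence half is summit-implied. [cite: KontsevichZagier2001, §1.2 Conjecture 1] -/
theorem regLiftGradedLevel_of_kzKernelConjecture (hK : KZKernelConjecture) : ∀ (E : ℕ), (∀ (x : KZ.FormalRep), x ∈ AddSubgroup.closure {y : KZ.FormalRep | ∃ (n : ℕ) (r : KZ.IntegralRep n), n < E ∧ y = KZ.of r} → KZ.eval x = 0 → ∃ H ∈ KZ.fibredRelations, ∃ (k : ℕ) (m : Fin k → ℤ) (p q b d : Fin k → ℕ) (ρ : (i : Fin k) → KZ.IntegralRep (d i)) (P : (i : Fin k) → KZ.IntegralRep (b i + d i + 1 + 1)) (k₂ : ℕ) (d₂ : Fin k₂ → ℕ) (m₂ : Fin k₂ → ℤ) (R : (j : Fin k₂) → KZ.IntegralRep (d₂ j + 1)) (r₀ g : (j : Fin k₂) → KZ.IntegralRep (d₂ j)), (∀ i, 0 < q i ∧ p i < q i ∧ (0 < p i ∨ 0 < b i) ∧ d i + 1 <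 E ∧ (P i).domain = {z | ∃ (s u : ℝ) (y : Fin (b i) → ℝ) (w : Fin (d i) → ℝ), z = Matrix.vecCons s (Matrix.vecCons u (Fin.append y w)) ∧ 0 < s ∧ s < 1 ∧ 0 < u ∧ u ^ (q i) * s ^ (p i) < 1 ∧ (∀ j, s ≤ y j ∧ y j ≤ 1) ∧ w ∈ (ρ i).domain} ∧ (P i).integrand = fun z => (∏ j : Fin (b i), (z (Fin.castAdd (d i) j).succ.succ)⁻¹) * (ρ i).integrand (fun l : Fin (d i) => z (Fin.natAdd (b i) l).succ.succ)) ∧ (∀ j, d₂ j < E ∧ KZ.IsDominatedFamily (R j) (r₀ j) (g j)) ∧ H = (∑ i, m i • KZ.of (P i)) + (∑ j, m₂ j • KZ.of (R j)) ∧ (∑ j, m₂ j • KZ.of (r₀ j)) - x ∈ KZ.relations) :=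
  fun E => stub_regLiftGradedLevel_of_kernelLevel E (kernelLevel_of_kzKernelConjecture hK E)

/-- **`KZKernelConjecture` ⇒ SFG(`E`) on every level** (value shadow over `kernelLevel_of_kzKernelConjecture`): the
conservativity half is summit-implied. [cite: KontsevichZagier2001, §1.2 Conjecture 1] -/
theorem specialFibreGraded_of_kzKernelConjecture (hK : KZKernelConjecture) : ∀ (E : ℕ), (∀ (k : ℕ) (d : Fin k → ℕ) (m : Fin k → ℤ) (R : (i : Fin k) → KZ.IntegralRep (d i + 1)) (r₀ g : (i : Fin k) → KZ.IntegralRep (d i)), (∀ i, d i < E) → (∀ i, KZ.IsDominatedFamily (R i) (r₀ i) (g i)) → (∑ i, m i • KZ.of (R i)) ∈ KZ.fibredRelations → (∑ i, m i • KZ.of (r₀ i)) ∈ KZ.relations) :=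
  fun E => stub_specialFibreGraded_of_kernelLevel E (kernelLevel_of_kzKernelConjecture hK E)

end Summit.KontsevichZagierPeriods.ValuedFieldSpecialisation
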